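import Summits.QuantumFields.BalabanUV.Beta.GAN24.DerivativeRateTransferJensenMassFreeKarcherContraction
import Literature.Analysis.Calculus.ExpDifferentialAdSeries
import Mathlib.Analysis.Calculus.FDeriv.OfCompLeft

/-!
# `BalabanUV.Beta.GAN24.DerivativeRateTransferJensenMassFreeLogChart` — binder row G-an2-4 ∕ (CONV-C), route R6 «VALUES, NOT DERIVATIVES», PART 78:
# THE SMALL LOGARITHM IS A DIFFERENTIABLE CHART, AND THE LOGARITHM ALONG AN EXPONENTIAL CURVE SATISFIES BAŁABAN's (32) — in any complete normed `ℝ`-algebra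
# PART 69's small logarithm `L` (`‖L y‖ ≤ 1∕4`, `exp(L y) = y` on `‖y − 1‖ ≤ 1∕8`) is Fréchet differentiable on the open ball with derivative inverting the
# tree's `D exp` (`ExpDifferential.dexp`), and along `t ↦ exp A·exp(tE)` the logarithm `f(t)` has a derivative `f′(t)` with `g(ad_{f(t)})f′(t) = E`
# (`g(z) = (1 − e^{−z})∕z`, the tree's `gSer`) — the calculus the Gauss lemma (PART 79) runs on (unit b2b-balaban-gan24-p3, gen 46; v1)

NOT IN PRINT; OUR PROOF (for the ROUTE; [folklore] — the tree's `Literature.Analysis.Calculus.ExpDifferentialAdSeries` (`dexp_eq : D exp_X = L_{eˣ}·g(ad X)`,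
`hasFDerivAt_exp_dexp`, `isUnit_gSer`, [Varadarajan 1984 Thm 2.14.3; Hall 2015 Thm 5.4; Bałaban CMP 98 (1985) (32)–(34)]) BY NAME, Mathlib's
`HasFDerivAt.of_local_left_inverse`, `ContinuousLinearEquiv.unitsEquiv`, `hasDerivAt_exp_smul_const`, PART 69 `norm_sub_le_two_mul_norm_exp_sub`, PART 76's
window letters).  HONEST FRAMING (cell contract, verbatim): «discharging `BetaPertH` makes Bałaban's UV stability UNCONDITIONAL — a real constructive-QFT result;
it is NOT the continuum limit and NOT the Clay problem.»  HONEST DEPENDENCY (verbatim): «continuum YM on T⁴ ⇐ BetaPertH ∧ nine spine estimates (0/9 proved);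
BetaPertH ⇐ (D1) ∧ (D4) ∧ CAP+tail; G-an2-4 gates asym, D1 and NE2/3/4.»

WHY THIS FILE.  PARTs 76 ∕ 77 solve Bałaban–Jaffe's (1.29) without derivatives; that its solution MINIMISES Federbush's `d(V) = Σ_x dist²(U(Γ_x), V)` of (1.27)
[Erice 1985 p. 221] needs the first variation of `V ↦ ‖log(τVᵀ)‖²` — the Gauss lemma of the bi-invariant metric.  THIS FILE supplies the calculus:
* **`isUnit_dexp`**: `D exp_X = L_{eˣ}·g(ad X)` is a unit of the Banach algebra `𝔸 →L[ℝ] 𝔸` for `‖X‖ ≤ 1∕2` (`L_{eˣ}` has inverse `L_{e⁻ˣ}`; `‖ad X‖ ≤ 2‖X‖ ≤ 1`).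
* **`exists_log_chart`**: a map `L : 𝔸 → 𝔸` with `‖L y‖ ≤ 1∕4`, `exp(L y) = y` for `‖y − 1‖ ≤ 1∕8`, and for `‖y − 1‖ < 1∕8` a continuous linear `L′_y` with
  `HasFDerivAt L L′_y y` and `dexp (L y) (L′_y h) = h` — `L` is `2`-Lipschitz on the ball (PART 69), `exp ∘ L = id` near `y`, `D exp_{L y}` invertible.
* **`exists_log_curve`**: for `‖A‖ ≤ 1∕100`, `‖E‖ ≤ 1∕50` there are `f, f′ : ℝ → 𝔸` with `f 0 = A` and on `[0,1]`: `‖f t‖ ≤ 1∕4`, `exp(f t) = exp A·exp(tE)`,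
  `HasDerivAt f (f′ t) t`, **`g(ad_{f t})(f′ t) = E`** (from `D exp_{f}(f′) = (e^{A}e^{tE})′ = e^{f}·E` and `D exp_f = L_{e^f}g(ad f)`), `‖f t‖ ≤ ‖A‖ + (3∕2)‖E‖`.

HONEST SCOPE.  The chart is PART 69's small logarithm (radius `1∕8` about `1`), not a global one; windows crude; no structure group; NOT the tower, NOT (CONS),
NOT (CONV-C).

WHAT THIS FILE PROVES (0 sorry, 0 `def`, nothing cited): **`isUnit_dexp`**, **`exists_log_chart`**, `norm_smul_le_of_mem_Icc`, **`exists_log_curve`**.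
SUPPLIER work on route R6 (rank 2, REDUCTION, no seat); no consumer of record; NEVER «G-an2-4 closed»; NOT (CONV-C), NOT D1, NOT `BetaPertH`, NOT continuum,
NOT Clay.  Records: `HOME/b2b-balaban-gan24-p3/WOODBURY-FIBRE.md` v14.6. -/

noncomputable section

open scoped NNReal Topology Nat
open NormedSpace Finset Metric Set Filter

namespace Summit.QuantumFields.BalabanUV.Beta.GAN24.DerivativeRateTransferJensenMassFreeLogChart

open Literature.Analysis.Calculus.ExpDifferential
open Summit.QuantumFields.BalabanUV.Beta.GAN24.DerivativeRateTransferJensenMassFreeExpTaylor (norm_exp_sub_one_le)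
open Summit.QuantumFields.BalabanUV.Beta.GAN24.DerivativeRateTransferJensenMassFreeLogarithm
open Summit.QuantumFields.BalabanUV.Beta.GAN24.DerivativeRateTransferJensenMassFreeKarcherContraction

/-! ## §1 The small-logarithm chart and the logarithm along an exponential curve (any complete normed real algebra) -/

section Banach

variable {𝔸 : Type*} [NormedRing 𝔸] [NormedAlgebra ℝ 𝔸] [CompleteSpace 𝔸]

/-- **`isUnit_dexp`**: the differential `D exp_X = L_{eˣ}·g(ad X)` of the tree (`ExpDifferential.dexp_eq`) is invertible for `‖X‖ ≤ 1∕2`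
(`L_{eˣ}` has inverse `L_{e⁻ˣ}`; `g(ad X)` is a unit for `‖ad X‖ ≤ 2‖X‖ ≤ 1`, the tree's `isUnit_gSer`). [folklore] -/
theorem isUnit_dexp {X : 𝔸} (hX : ‖X‖ ≤ 1 / 2) : IsUnit (dexp ℝ X) := by
  rw [dexp_eq]
  refine IsUnit.mul ?_ (isUnit_gSer ((norm_ad_le X).trans (by linarith)))
  refine ⟨⟨mulL ℝ (exp X), mulL ℝ (exp (-X)), ?_, ?_⟩, rfl⟩
  · ext h
    show exp X * (exp (-X) * h) = h
    rw [← mul_assoc, exp_mul_exp_neg_eq_one (𝕂 := ℝ), one_mul]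
  · ext h
    show exp (-X) * (exp X * h) = h
    rw [← mul_assoc, exp_neg_mul_exp_eq_one (𝕂 := ℝ), one_mul]

/-- **`exists_log_chart` — THE SMALL LOGARITHM IS A DIFFERENTIABLE CHART** [folklore; our proof]: there is `L : 𝔸 → 𝔸` with `‖L y‖ ≤ 1∕4`,
`exp(L y) = y` on the closed ball `‖y − 1‖ ≤ 1∕8` (PART 69), which on the open ball is Fréchet differentiable with a derivative `L′_y` inverting
`D exp_{L y}`: `dexp (L y) (L′_y h) = h` (Mathlib's `HasFDerivAt.of_local_left_inverse`: `L` is `2`-Lipschitz there by PART 69, `exp ∘ L = id` near `y`,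
and `D exp_{L y}` is a unit). -/
theorem exists_log_chart :
    ∃ L : 𝔸 → 𝔸, (∀ y, ‖y - 1‖ ≤ 1 / 8 → ‖L y‖ ≤ 1 / 4 ∧ exp (L y) = y) ∧
      ∀ y, ‖y - 1‖ < 1 / 8 → ∃ L' : 𝔸 →L[ℝ] 𝔸, HasFDerivAt L L' y ∧ ∀ h, dexp ℝ (L y) (L' h) = h := by
  classical
  let L : 𝔸 → 𝔸 := fun y => if h : ‖y - 1‖ ≤ 1 / 8 then Classical.choose (exists_exp_eq_of_norm_sub_one_le h) else 0
  have hL : ∀ y, ‖y - 1‖ ≤ 1 / 8 → ‖L y‖ ≤ 1 / 4 ∧ exp (L y) = y := fun y hy => by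
    simp only [L, dif_pos hy]
    exact Classical.choose_spec (exists_exp_eq_of_norm_sub_one_le hy)
  refine ⟨L, hL, fun a ha => ?_⟩
  have hball : ball (1 : 𝔸) (1 / 8) ∈ 𝓝 a := Metric.isOpen_ball.mem_nhds (by rw [mem_ball, dist_eq_norm]; exact ha)
  have hcont : ContinuousAt L a := by
    have hon : ContinuousOn L (ball (1 : 𝔸) (1 / 8)) := by
      refine (LipschitzOnWith.of_dist_le_mul (K := 2) fun y hy y' hy' => ?_).continuousOn
      rw [mem_ball, dist_eq_norm] at hy hy'
      have h := norm_sub_le_two_mul_norm_exp_sub (hL y hy.le).1 (hL y' hy'.le).1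
      rw [(hL y hy.le).2, (hL y' hy'.le).2] at h
      rw [dist_eq_norm, dist_eq_norm, NNReal.coe_ofNat]
      exact h
    exact hon.continuousAt hball
  have hu : IsUnit (dexp ℝ (L a)) := isUnit_dexp ((hL a ha.le).1.trans (by norm_num))
  let Φ : 𝔸 ≃L[ℝ] 𝔸 := ContinuousLinearEquiv.unitsEquiv ℝ 𝔸 hu.unit
  have hΦ : (Φ : 𝔸 →L[ℝ] 𝔸) = dexp ℝ (L a) := by
    ext h
    rw [ContinuousLinearEquiv.coe_coe, ContinuousLinearEquiv.unitsEquiv_apply, IsUnit.unit_spec]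
  have hexp : HasFDerivAt (exp : 𝔸 → 𝔸) (Φ : 𝔸 →L[ℝ] 𝔸) (L a) := by
    rw [hΦ]; exact hasFDerivAt_exp_dexp (L a)
  have hfg : ∀ᶠ y in 𝓝 a, exp (L y) = y :=
    Filter.mem_of_superset hball fun y hy => (hL y (by rw [mem_ball, dist_eq_norm] at hy; exact hy.le)).2
  have hderiv := HasFDerivAt.of_local_left_inverse hcont hexp hfg
  refine ⟨(Φ.symm : 𝔸 →L[ℝ] 𝔸), hderiv, fun h => ?_⟩
  rw [← hΦ]
  simp only [ContinuousLinearEquiv.coe_coe, ContinuousLinearEquiv.apply_symm_apply]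

omit [CompleteSpace 𝔸] in
/-- `‖t•E‖ ≤ ‖E‖` for `t ∈ [0,1]`. -/
theorem norm_smul_le_of_mem_Icc {E : 𝔸} {t : ℝ} (ht : t ∈ Icc (0 : ℝ) 1) : ‖t • E‖ ≤ ‖E‖ := by
  rw [norm_smul, Real.norm_eq_abs, abs_of_nonneg ht.1]
  exact (mul_le_mul_of_nonneg_right ht.2 (norm_nonneg E)).trans (by rw [one_mul])

/-- **`exists_log_curve` — THE LOGARITHM ALONG `t ↦ exp A · exp(tE)`** [our proof]: in the window `‖A‖ ≤ 1∕100`, `‖E‖ ≤ 1∕50` there are `f, f′ : ℝ → 𝔸`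
with `f 0 = A` and, for every `t ∈ [0,1]`: `‖f t‖ ≤ 1∕4`, `exp(f t) = exp A · exp(tE)`, `f` has derivative `f′ t` at `t`, the DERIVATIVE EQUATION
`g(ad_{f t})(f′ t) = E` (Bałaban's (32): `e^{−f}(e^{f})′ = g(ad_f) f′`, and `(e^A e^{tE})′ = e^A e^{tE}·E`), and `‖f t‖ ≤ ‖A‖ + (3∕2)‖E‖`. -/
theorem exists_log_curve {A E : 𝔸} (hA : ‖A‖ ≤ 1 / 100) (hE : ‖E‖ ≤ 1 / 50) :
    ∃ f f' : ℝ → 𝔸, f 0 = A ∧ ∀ t ∈ Icc (0 : ℝ) 1, ‖f t‖ ≤ 1 / 4 ∧ exp (f t) = exp A * exp (t • E) ∧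
      HasDerivAt f (f' t) t ∧ gSer ℝ (ad ℝ (f t)) (f' t) = E ∧ ‖f t‖ ≤ ‖A‖ + 3 / 2 * ‖E‖ := by
  obtain ⟨L, hL, hLd⟩ := exists_log_chart (𝔸 := 𝔸)
  let G : ℝ → 𝔸 := fun t => exp A * exp (t • E)
  have hGt : ∀ t ∈ Icc (0 : ℝ) 1, ‖-(t • E)‖ ≤ 1 / 50 := fun t ht => by
    rw [norm_neg]; exact (norm_smul_le_of_mem_Icc ht).trans hE
  have hG1 : ∀ t ∈ Icc (0 : ℝ) 1, ‖G t - 1‖ ≤ 1 / 16 := fun t ht => by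
    have h := norm_exp_mul_exp_neg_sub_one_le_sixteenth hA (hGt t ht)
    rwa [neg_neg] at h
  have hGd : ∀ t, HasDerivAt G (G t * E) t := fun t => by
    have h := (hasDerivAt_exp_smul_const (𝕂 := ℝ) E t).const_mul (exp A)
    simpa only [G, mul_assoc] using h
  let f : ℝ → 𝔸 := fun t => L (G t)
  have hfd : ∀ t ∈ Icc (0 : ℝ) 1, ∃ v : 𝔸, HasDerivAt f v t ∧ dexp ℝ (f t) v = G t * E := fun t ht => by
    obtain ⟨L', hL', hL'inv⟩ := hLd (G t) (by linarith [hG1 t ht])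
    exact ⟨L' (G t * E), hL'.comp_hasDerivAt t (hGd t), hL'inv _⟩
  choose! f' hf'd hf'e using hfd
  have hf : ∀ t ∈ Icc (0 : ℝ) 1, ‖f t‖ ≤ 1 / 4 ∧ exp (f t) = G t := fun t ht => hL (G t) (by linarith [hG1 t ht])
  refine ⟨f, f', ?_, fun t ht => ⟨(hf t ht).1, (hf t ht).2, hf'd t ht, ?_, ?_⟩⟩
  · have h0 := hf 0 ⟨le_refl 0, zero_le_one⟩
    refine log_unique h0.1 (hA.trans (by norm_num)) (h0.2.trans ?_)
    show exp A * exp ((0 : ℝ) • E) = exp A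
    rw [zero_smul, exp_zero, mul_one]
  · have h := hf'e t ht
    rw [dexp_apply, ← (hf t ht).2] at h
    calc gSer ℝ (ad ℝ (f t)) (f' t) = exp (-f t) * (exp (f t) * gSer ℝ (ad ℝ (f t)) (f' t)) := by
          rw [← mul_assoc, exp_neg_mul_exp_eq_one (𝕂 := ℝ), one_mul]
      _ = exp (-f t) * (exp (f t) * E) := by rw [h]
      _ = E := by rw [← mul_assoc, exp_neg_mul_exp_eq_one (𝕂 := ℝ), one_mul]
  · have h := karcher_log_norm_le hA (hGt t ht) (hf t ht).1 (by rw [neg_neg]; exact (hf t ht).2)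
    rw [norm_neg] at h
    linarith [norm_smul_le_of_mem_Icc (E := E) ht]

end Banach

end Summit.QuantumFields.BalabanUV.Beta.GAN24.DerivativeRateTransferJensenMassFreeLogChart

end
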